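import Summits.AtomisticToContinuum.HydrodynamicLimit.Theses.BoxDissipativeWeakStrong
import Summits.AtomisticToContinuum.HydrodynamicLimit.Theorems.BoxDissipativeWeakStrongDefs
import Summits.AtomisticToContinuum.HydrodynamicLimit.Theorems.BoxDissipativeWeakStrongEntropyAdmissibilityStubDynPartIntegrable
import Summits.AtomisticToContinuum.HydrodynamicLimit.Theorems.BoxDissipativeWeakStrongEntropyAdmissibilityStubInitialEntropyLLN

/-!
# Crux `EntropyAdmissibility` (stmt-AtomisticToContinuum-9903), line `registered` — stub `stub_entropyBalanceConcentration_of_PTBCA`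

Toolbox (file A of two) for the registered stub S2b `stub_entropyBalanceConcentration_of_PTBC` (S2 = "no anomalous
entropy fluctuations" from the positive-time box concentration S2a) of the line `registered` of the crux
`Summit.AtomisticToContinuum.HydrodynamicLimit.Theses.BoxDissipativeWeakStrong.EntropyAdmissibility`; anchored to the
crux item by the registered helper stub `stub_entropyBalanceConcentration_of_PTBCA` (a conjunction of three of the facts
below). Contents (pure measure theory, and statics of the box fields of an ARBITRARY configuration):
* `L¹(P_N)`-concentration about the Bochner mean (`∫⁻ ofReal |f_N − ∫ f_N dP_N| dP_N → 0`, as in the crux) is stable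
  under a.e. modification, constant multiples and finite sums of integrable sequences, costs at most twice the `L¹`
  distance to any constant, and passes to TIME INTEGRALS (`tendsto_conc_integral`: joint measurability, an affine
  bound `|g_N(t,z)| ≤ C + D W_N(z)` with `sup_N E W_N < ∞`, Tonelli and dominated convergence in `t`);
* the box kernel is symmetric, so `∫ K_ℓ(x, y) dx = 1` (`LGFS.integral_boxK_right`), the box density has unit
  `x`-mass and `∫ ‖m̂‖ dx ≤ (N+1)⁻¹ Σ‖vᵢ‖ ≤ 1/2 + ½(N+1)⁻¹Σ‖vᵢ‖²`; hence the `N`-UNIFORM bound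
  `|∫ G(Û) ψ dx| ≤ D(3/2 + ½(N+1)⁻¹Σ‖vᵢ‖²)` for linear-growth `G`, and `E_{P_N}[(N+1)⁻¹Σ‖vᵢ‖²] ≤ U² + 3Θ`
  uniformly in `N` (`lintegral_meanVelObs_localGibbsMeasure_le`).

References: J. Březina, E. Feireisl, J. Math. Soc. Japan 70 (2018), Def. 2.9, §3.2; H. Spohn, *Large Scale
Dynamics of Interacting Particles* (1991), Part I Ch. 3. prover-line-stmt-AtomisticToContinuum-9903-0 (worker S2b).
-/

noncomputable section

open MeasureTheory Filter Set
open scoped ENNReal Topology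


namespace Summit.AtomisticToContinuum.HydrodynamicLimit.Theorems.EABirthS2bA

open Literature.MathematicalPhysics.KineticTheory
open Literature.Analysis.FluidPDE.CompressibleEuler (clamp)
open Summit.AtomisticToContinuum.HydrodynamicLimit.Theses
open Summit.AtomisticToContinuum.HydrodynamicLimit.Theorems.BDWS
open Literature.Analysis.FluidPDE (Config configEnergy HardSphereFlow)

/-! ## `L¹` concentration about the mean: algebra -/

section Conc

variable {Ω : ℕ → Type*} [∀ N, MeasurableSpace (Ω N)] (P : ∀ N, Measure (Ω N))

/-- **Concentration about the mean from concentration about a constant.** On a probability space,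
for an integrable real `f` and any constant `c`, `∫⁻ |f − ∫ f| ≤ 2 ∫⁻ |f − c|`. -/
theorem lintegral_ofReal_abs_sub_integral_le {Ω' : Type*} [MeasurableSpace Ω'] (μ : Measure Ω')
    [IsProbabilityMeasure μ] {f : Ω' → ℝ} (hf : Integrable f μ) (c : ℝ) :
    ∫⁻ ω, ENNReal.ofReal |f ω - ∫ ω', f ω' ∂μ| ∂μ ≤ 2 * ∫⁻ ω, ENNReal.ofReal |f ω - c| ∂μ := by
  set m : ℝ := ∫ ω', f ω' ∂μ with hm
  have hgap : ENNReal.ofReal |c - m| ≤ ∫⁻ ω, ENNReal.ofReal |f ω - c| ∂μ := by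
    have hcm : c - m = ∫ ω, (c - f ω) ∂μ := by
      rw [integral_sub (integrable_const c) hf, integral_const]; simp [hm]
    rw [show ENNReal.ofReal |c - m| = ‖∫ ω, (c - f ω) ∂μ‖ₑ by rw [hcm, Real.enorm_eq_ofReal_abs]]
    refine (enorm_integral_le_lintegral_enorm _).trans (le_of_eq (lintegral_congr fun ω => ?_))
    rw [Real.enorm_eq_ofReal_abs, abs_sub_comm]
  calc ∫⁻ ω, ENNReal.ofReal |f ω - m| ∂μ
      ≤ ∫⁻ ω, (ENNReal.ofReal |f ω - c| + ENNReal.ofReal |c - m|) ∂μ := lintegral_mono fun ω => by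
        rw [← ENNReal.ofReal_add (abs_nonneg _) (abs_nonneg _)]
        exact ENNReal.ofReal_le_ofReal (abs_sub_le _ _ _)
    _ = (∫⁻ ω, ENNReal.ofReal |f ω - c| ∂μ) + ENNReal.ofReal |c - m| := by
        rw [lintegral_add_right _ measurable_const, lintegral_const, measure_univ, mul_one]
    _ ≤ 2 * ∫⁻ ω, ENNReal.ofReal |f ω - c| ∂μ := by rw [two_mul]; exact add_le_add le_rfl hgap

/-- Concentration about the mean is invariant under a.e. modification. -/
theorem tendsto_conc_congr_ae {f g : ∀ N, Ω N → ℝ} (hfg : ∀ N, f N =ᵐ[P N] g N)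
    (hf : Tendsto (fun N => ∫⁻ z, ENNReal.ofReal |f N z - ∫ z', f N z' ∂P N| ∂P N) atTop (𝓝 0)) :
    Tendsto (fun N => ∫⁻ z, ENNReal.ofReal |g N z - ∫ z', g N z' ∂P N| ∂P N) atTop (𝓝 0) := by
  refine hf.congr fun N => ?_
  rw [integral_congr_ae (hfg N)]
  refine lintegral_congr_ae ?_
  filter_upwards [hfg N] with z hz
  rw [hz]

/-- Concentration about the mean is stable under constant multiples. -/
theorem tendsto_conc_const_mul {f : ∀ N, Ω N → ℝ} (c : ℝ)
    (hf : Tendsto (fun N => ∫⁻ z, ENNReal.ofReal |f N z - ∫ z', f N z' ∂P N| ∂P N) atTop (𝓝 0)) :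
    Tendsto (fun N => ∫⁻ z, ENNReal.ofReal |c * f N z - ∫ z', c * f N z' ∂P N| ∂P N) atTop (𝓝 0) := by
  have h : ∀ N, (∫⁻ z, ENNReal.ofReal |c * f N z - ∫ z', c * f N z' ∂P N| ∂P N) =
      ENNReal.ofReal |c| * ∫⁻ z, ENNReal.ofReal |f N z - ∫ z', f N z' ∂P N| ∂P N := fun N => by
    rw [integral_const_mul, ← lintegral_const_mul' _ _ ENNReal.ofReal_ne_top]
    refine lintegral_congr fun z => ?_
    rw [← mul_sub, abs_mul, ENNReal.ofReal_mul (abs_nonneg c)]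
  have h2 := ENNReal.Tendsto.const_mul hf (Or.inr ENNReal.ofReal_ne_top) (a := ENNReal.ofReal |c|)
  rw [mul_zero] at h2
  exact h2.congr fun N => (h N).symm

/-- Concentration about the mean is stable under sums of integrable sequences. -/
theorem tendsto_conc_add {f g : ∀ N, Ω N → ℝ} (hfi : ∀ N, Integrable (f N) (P N))
    (hgi : ∀ N, Integrable (g N) (P N))
    (hf : Tendsto (fun N => ∫⁻ z, ENNReal.ofReal |f N z - ∫ z', f N z' ∂P N| ∂P N) atTop (𝓝 0))
    (hg : Tendsto (fun N => ∫⁻ z, ENNReal.ofReal |g N z - ∫ z', g N z' ∂P N| ∂P N) atTop (𝓝 0)) :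
    Tendsto (fun N => ∫⁻ z, ENNReal.ofReal
      |(f N z + g N z) - ∫ z', (f N z' + g N z') ∂P N| ∂P N) atTop (𝓝 0) := by
  have hsum := hf.add hg
  rw [add_zero] at hsum
  refine tendsto_of_tendsto_of_tendsto_of_le_of_le' tendsto_const_nhds hsum
    (Eventually.of_forall fun N => bot_le) (Eventually.of_forall fun N => ?_)
  have hmeas : AEMeasurable (fun z => ENNReal.ofReal |f N z - ∫ z', f N z' ∂P N|) (P N) :=
    (continuous_abs.measurable.comp_aemeasurable
      ((hfi N).aestronglyMeasurable.aemeasurable.sub aemeasurable_const)).ennreal_ofReal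
  calc ∫⁻ z, ENNReal.ofReal |(f N z + g N z) - ∫ z', (f N z' + g N z') ∂P N| ∂P N
      ≤ ∫⁻ z, (ENNReal.ofReal |f N z - ∫ z', f N z' ∂P N| +
          ENNReal.ofReal |g N z - ∫ z', g N z' ∂P N|) ∂P N := lintegral_mono fun z => by
        rw [integral_add (hfi N) (hgi N), ← ENNReal.ofReal_add (abs_nonneg _) (abs_nonneg _),
          add_sub_add_comm]
        exact ENNReal.ofReal_le_ofReal (abs_add_le _ _)
    _ = _ := lintegral_add_left' hmeas _

/-- Concentration about the mean is stable under finite sums of integrable sequences. -/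
theorem tendsto_conc_finsetSum {ι : Type*} (s : Finset ι) {f : ι → ∀ N, Ω N → ℝ}
    (hfi : ∀ i ∈ s, ∀ N, Integrable (f i N) (P N))
    (hf : ∀ i ∈ s, Tendsto (fun N => ∫⁻ z, ENNReal.ofReal
      |f i N z - ∫ z', f i N z' ∂P N| ∂P N) atTop (𝓝 0)) :
    Tendsto (fun N => ∫⁻ z, ENNReal.ofReal
      |(∑ i ∈ s, f i N z) - ∫ z', (∑ i ∈ s, f i N z') ∂P N| ∂P N) atTop (𝓝 0) := by
  classical
  induction s using Finset.induction_on with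
  | empty => simp
  | insert i s hi ih =>
    simp only [Finset.sum_insert hi]
    exact tendsto_conc_add P (hfi i (Finset.mem_insert_self i s))
      (fun N => integrable_finsetSum s fun j hj => hfi j (Finset.mem_insert_of_mem hj) N)
      (hf i (Finset.mem_insert_self i s))
      (ih (fun j hj => hfi j (Finset.mem_insert_of_mem hj)) fun j hj => hf j (Finset.mem_insert_of_mem hj))

/-- A measurable nonnegative function with `∫⁻ ofReal W ≤ ofReal K` is integrable with `∫ W ≤ K`. -/
theorem integrable_of_lintegral_ofReal_le {Ω' : Type*} [MeasurableSpace Ω'] {μ : Measure Ω'} {W : Ω' → ℝ}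
    (hW : Measurable W) (hW0 : ∀ z, 0 ≤ W z) {K : ℝ} (hK : 0 ≤ K)
    (h : ∫⁻ z, ENNReal.ofReal (W z) ∂μ ≤ ENNReal.ofReal K) : Integrable W μ ∧ ∫ z, W z ∂μ ≤ K := by
  have hi : Integrable W μ := ⟨hW.aestronglyMeasurable,
    (hasFiniteIntegral_iff_ofReal (Eventually.of_forall hW0)).2 (h.trans_lt ENNReal.ofReal_lt_top)⟩
  refine ⟨hi, (ENNReal.ofReal_le_ofReal_iff hK).1 ?_⟩
  rwa [ofReal_integral_eq_lintegral_ofReal hi (Eventually.of_forall hW0)]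

/-- Affine domination by an integrable weight gives integrability. -/
theorem integrable_of_abs_le_affine {Ω' : Type*} [MeasurableSpace Ω'] {μ : Measure Ω'} [IsFiniteMeasure μ]
    {f W : Ω' → ℝ} (hf : AEStronglyMeasurable f μ) (hW : Integrable W μ) {C D : ℝ}
    (h : ∀ z, |f z| ≤ C + D * W z) : Integrable f μ :=
  ((integrable_const C).add (hW.const_mul D)).mono' hf
    (Eventually.of_forall fun z => by rw [Real.norm_eq_abs]; exact h z)

/-- **Concentration of time integrals.** On probability spaces `(Ω_N, P_N)` and a finite measure space
`(γ, ν)`: if `g_N : γ × Ω_N → ℝ` is jointly measurable with `|g_N(t, z)| ≤ C + D W_N(z)`, `W_N ≥ 0` measurable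
with `E_{P_N} W_N ≤ K` uniformly, and `g_N(t, ·)` concentrates about its mean in `L¹(P_N)` for `ν`-a.e. `t`,
then `z ↦ ∫ g_N(t, z) dν(t)` is `P_N`-integrable and concentrates about its mean in `L¹(P_N)`. -/
theorem tendsto_conc_integral (hP : ∀ N, IsProbabilityMeasure (P N)) {γ : Type*} [MeasurableSpace γ]
    (ν : Measure γ) [IsFiniteMeasure ν] {g : ∀ N, γ → Ω N → ℝ} {W : ∀ N, Ω N → ℝ} {C D K : ℝ}
    (hg : ∀ N, Measurable fun p : γ × Ω N => g N p.1 p.2) (hW : ∀ N, Measurable (W N))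
    (hW0 : ∀ N z, 0 ≤ W N z) (hWK : ∀ N, ∫⁻ z, ENNReal.ofReal (W N z) ∂P N ≤ ENNReal.ofReal K)
    (hC : 0 ≤ C) (hD : 0 ≤ D) (hK : 0 ≤ K) (hbd : ∀ N t z, |g N t z| ≤ C + D * W N z)
    (hconc : ∀ᵐ t ∂ν, Tendsto (fun N => ∫⁻ z, ENNReal.ofReal
      |g N t z - ∫ z', g N t z' ∂P N| ∂P N) atTop (𝓝 0)) :
    (∀ N, Integrable (fun z => ∫ t, g N t z ∂ν) (P N)) ∧
      Tendsto (fun N => ∫⁻ z, ENNReal.ofReal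
        |(∫ t, g N t z ∂ν) - ∫ z', (∫ t, g N t z' ∂ν) ∂P N| ∂P N) atTop (𝓝 0) := by
  haveI := hP
  -- the mean `m N t = E g_N(t)` and its properties
  set m : ∀ N, γ → ℝ := fun N t => ∫ z', g N t z' ∂P N with hm
  have hm_meas : ∀ N, Measurable (m N) := fun N =>
    ((hg N).stronglyMeasurable.integral_prod_right' (ν := P N)).measurable
  have hWi : ∀ N, Integrable (W N) (P N) ∧ ∫ z, W N z ∂P N ≤ K := fun N =>
    integrable_of_lintegral_ofReal_le (hW N) (hW0 N) hK (hWK N)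
  have hgz : ∀ N t, Integrable (g N t) (P N) := fun N t =>
    integrable_of_abs_le_affine ((hg N).comp (measurable_const.prodMk measurable_id)).aestronglyMeasurable
      (hWi N).1 (hbd N t)
  have hgt : ∀ N z, Integrable (fun t => g N t z) ν := fun N z =>
    integrable_of_abs_le_affine (W := fun _ => W N z) (D := D)
      ((hg N).comp (measurable_id.prodMk measurable_const)).aestronglyMeasurable (integrable_const _)
      (fun t => hbd N t z)
  have hm_bd : ∀ N t, |m N t| ≤ C + D * K := fun N t => by
    have h1 : |m N t| ≤ ∫ z, (C + D * W N z) ∂P N := by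
      rw [← Real.norm_eq_abs]
      exact norm_integral_le_of_norm_le ((integrable_const C).add ((hWi N).1.const_mul D))
        (Eventually.of_forall fun z => by rw [Real.norm_eq_abs]; exact hbd N t z)
    rw [integral_add (integrable_const C) ((hWi N).1.const_mul D), integral_const, integral_const_mul,
      probReal_univ, one_smul] at h1
    nlinarith [(hWi N).2]
  have hmi : ∀ N, Integrable (m N) ν := fun N =>
    integrable_of_abs_le_affine (W := fun _ => K) (D := D) (hm_meas N).aestronglyMeasurable
      (integrable_const _) (hm_bd N)
  -- the `L¹` deviation at fixed `t`, `F N t`, is measurable and uniformly bounded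
  have hFm : ∀ N, Measurable fun p : γ × Ω N => ENNReal.ofReal |g N p.1 p.2 - m N p.1| := fun N =>
    (continuous_abs.measurable.comp ((hg N).sub ((hm_meas N).comp measurable_fst))).ennreal_ofReal
  have hF_bd : ∀ N t, (∫⁻ z, ENNReal.ofReal |g N t z - m N t| ∂P N) ≤ 2 * ENNReal.ofReal (C + D * K) := by
    refine fun N t => (lintegral_ofReal_abs_sub_integral_le (P N) (hgz N t) 0).trans (mul_le_mul' le_rfl ?_)
    calc ∫⁻ z, ENNReal.ofReal |g N t z - 0| ∂P N
        ≤ ∫⁻ z, (ENNReal.ofReal C + ENNReal.ofReal D * ENNReal.ofReal (W N z)) ∂P N := lintegral_mono fun z => by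
          rw [sub_zero, ← ENNReal.ofReal_mul hD, ← ENNReal.ofReal_add hC (mul_nonneg hD (hW0 N z))]
          exact ENNReal.ofReal_le_ofReal (hbd N t z)
      _ ≤ ENNReal.ofReal (C + D * K) := by
          rw [lintegral_add_left measurable_const, lintegral_const, measure_univ, mul_one,
            lintegral_const_mul' _ _ ENNReal.ofReal_ne_top, ENNReal.ofReal_add hC (mul_nonneg hD hK),
            ENNReal.ofReal_mul hD]
          exact add_le_add le_rfl (mul_le_mul' le_rfl (hWK N))
  -- dominated convergence in `t`
  have hDCT : Tendsto (fun N => ∫⁻ t, (∫⁻ z, ENNReal.ofReal |g N t z - m N t| ∂P N) ∂ν) atTop (𝓝 0) := by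
    have h := tendsto_lintegral_of_dominated_convergence (μ := ν) (fun _ => 2 * ENNReal.ofReal (C + D * K))
      (fun N => (hFm N).lintegral_prod_right') (fun N => Eventually.of_forall (hF_bd N))
      (by rw [lintegral_const]; exact ENNReal.mul_ne_top (ENNReal.mul_ne_top ENNReal.ofNat_ne_top
        ENNReal.ofReal_ne_top) (measure_ne_top _ _)) hconc
    simpa only [lintegral_zero] using h
  -- integrability of the time integral
  have hint : ∀ N, Integrable (fun z => ∫ t, g N t z ∂ν) (P N) := fun N =>
    integrable_of_abs_le_affine (C := C * ν.real univ) (D := D * ν.real univ)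
      ((hg N).comp measurable_swap).stronglyMeasurable.integral_prod_right'.aestronglyMeasurable (hWi N).1
      fun z => by
        have h := norm_integral_le_of_norm_le_const (μ := ν) (C := C + D * W N z) (f := fun t => g N t z)
          (Eventually.of_forall fun t => by rw [Real.norm_eq_abs]; exact hbd N t z)
        rw [Real.norm_eq_abs] at h
        nlinarith [h]
  refine ⟨hint, ?_⟩
  -- concentration about the constant `∫ m N dν`, then about the mean
  have hconst : Tendsto (fun N => ∫⁻ z, ENNReal.ofReal
      |(∫ t, g N t z ∂ν) - ∫ t, m N t ∂ν| ∂P N) atTop (𝓝 0) := by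
    refine tendsto_of_tendsto_of_tendsto_of_le_of_le' tendsto_const_nhds hDCT
      (Eventually.of_forall fun N => bot_le) (Eventually.of_forall fun N => ?_)
    calc (∫⁻ z, ENNReal.ofReal |(∫ t, g N t z ∂ν) - ∫ t, m N t ∂ν| ∂P N)
        ≤ ∫⁻ z, ∫⁻ t, ENNReal.ofReal |g N t z - m N t| ∂ν ∂P N := lintegral_mono fun z => by
          rw [← integral_sub (hgt N z) (hmi N), ← Real.enorm_eq_ofReal_abs]
          refine (enorm_integral_le_lintegral_enorm _).trans (le_of_eq (lintegral_congr fun t => ?_))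
          rw [Real.enorm_eq_ofReal_abs]
      _ = ∫⁻ t, (∫⁻ z, ENNReal.ofReal |g N t z - m N t| ∂P N) ∂ν :=
          lintegral_lintegral_swap ((hFm N).comp measurable_swap).aemeasurable
  have h2 := ENNReal.Tendsto.const_mul hconst (Or.inr ENNReal.ofNat_ne_top) (a := 2)
  rw [mul_zero] at h2
  exact tendsto_of_tendsto_of_tendsto_of_le_of_le' tendsto_const_nhds h2
    (Eventually.of_forall fun N => bot_le)
    (Eventually.of_forall fun N => lintegral_ofReal_abs_sub_integral_le (P N) (hint N) _)

end Conc

/-! ## Statics of the box fields of an arbitrary configuration -/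

section Statics

variable {N : ℕ}

/-- The box kernel is symmetric. -/
theorem boxKernel_comm (l : ℝ) (x y : T3) : boxKernel l x y = boxKernel l y x := by
  have h : (∀ i, ‖y i - x i‖ < l / 2) ↔ ∀ i, ‖x i - y i‖ < l / 2 :=
    forall_congr' fun i => by rw [norm_sub_rev]
  simp only [boxKernel, Set.indicator_apply, Set.mem_setOf_eq, h]

/-- Unit `x`-mass of the box kernel: `∫ K_ℓ(x, y) dx = 1` for `0 < ℓ ≤ 1`. -/
theorem integral_boxKernel_left {l : ℝ} (hl : 0 < l) (hl1 : l ≤ 1) (y : T3) : ∫ x, boxKernel l x y = 1 := by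
  simp_rw [boxKernel_comm l _ y]
  exact LGFS.integral_boxK_right hl hl1 y

/-- The triple of box fields `Û(w, x) = (ρ̂, m̂, Ê)` of the configuration `w` at the centre `x` (window `l`), so that
`(boxDensity σ ℓ Φ N t z x, boxMomentum σ ℓ Φ N t z x, boxEnergy σ ℓ Φ N t z x) = fields (ℓ N) (Φ_t z) x` by `rfl`. -/
def fields (l : ℝ) (w : Config (N + 1) (Fin 3) T3) (x : T3) : ℝ × V3 × ℝ :=
  (empiricalDensityField w (boxKernel l x), empiricalMomentumField w (boxKernel l x),
    empiricalEnergyField w (boxKernel l x))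

/-- The box fields are jointly measurable in `(w, x)`. -/
theorem measurable_fields_uncurry (l : ℝ) : Measurable fun q : Config (N + 1) (Fin 3) T3 × T3 => fields l q.1 q.2 :=
  (LGFS.measurable_empiricalDensityField_param (k := boxKernel l) (LGFS.measurable_boxK_uncurry l)).prodMk
    ((LGFS.measurable_empiricalMomentumField_param (k := boxKernel l) (LGFS.measurable_boxK_uncurry l)).prodMk
      (LGFS.measurable_empiricalEnergyField_param (k := boxKernel l) (LGFS.measurable_boxK_uncurry l)))

/-- The box fields of a configuration `w` are measurable in the centre `x`. -/
theorem measurable_fields (l : ℝ) (w : Config (N + 1) (Fin 3) T3) : Measurable (fields l w) := by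
  rw [show fields l w = (fun q : Config (N + 1) (Fin 3) T3 × T3 => fields l q.1 q.2) ∘ fun x => (w, x) from rfl]
  exact (measurable_fields_uncurry l).comp (measurable_const.prodMk measurable_id)

/-- The box fields of a configuration `w` are integrable in the centre `x`. -/
theorem integrable_fields {l : ℝ} (hl : 0 ≤ l) (w : Config (N + 1) (Fin 3) T3) :
    Integrable (fun x => empiricalDensityField w (boxKernel l x)) ∧
      Integrable (fun x => empiricalMomentumField w (boxKernel l x)) ∧
        Integrable (fun x => empiricalEnergyField w (boxKernel l x)) := by
  have hK : ∀ y : T3, Integrable fun x : T3 => boxKernel l x y := fun y =>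
    EABirthS0b.integrable_boxKernel_left hl y
  simp only [empiricalDensityField_eq_sum, empiricalMomentumField_eq_sum, empiricalEnergyField_eq_sum]
  exact ⟨(integrable_finsetSum _ fun i _ => hK _).const_mul _,
    (integrable_finsetSum _ fun i _ => (hK _).smul_const _).fun_smul _,
    (integrable_finsetSum _ fun i _ => (hK _).mul_const _).const_mul _⟩

/-- The box density is nonnegative. -/
theorem density_nonneg {l : ℝ} (hl : 0 ≤ l) (w : Config (N + 1) (Fin 3) T3) (x : T3) :
    0 ≤ empiricalDensityField w (boxKernel l x) := by
  rw [empiricalDensityField_eq_sum]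
  exact LGFS.avg_nonneg (g := boxKernel l x) (LGFS.boxK_nonneg hl x) _

/-- **Unit `x`-mass of the box density**: `∫ ρ̂(w, x) dx = 1` for every configuration `w`. -/
theorem integral_density_eq_one {l : ℝ} (hl : 0 < l) (hl1 : l ≤ 1) (w : Config (N + 1) (Fin 3) T3) :
    ∫ x, empiricalDensityField w (boxKernel l x) = 1 := by
  simp only [empiricalDensityField_eq_sum]
  rw [integral_const_mul, integral_finsetSum _ fun i _ => EABirthS0b.integrable_boxKernel_left hl.le _]
  simp only [integral_boxKernel_left hl hl1, Finset.sum_const, Finset.card_univ, Fintype.card_fin,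
    nsmul_eq_mul, mul_one]
  exact inv_mul_cancel₀ (by positivity)

/-- `∫ ‖m̂(w, x)‖ dx ≤ (N+1)⁻¹ Σᵢ ‖vᵢ‖`. -/
theorem integral_norm_momentum_le {l : ℝ} (hl : 0 < l) (hl1 : l ≤ 1) (w : Config (N + 1) (Fin 3) T3) :
    ∫ x, ‖empiricalMomentumField w (boxKernel l x)‖ ≤ ((N : ℝ) + 1)⁻¹ * ∑ i, ‖(w i).2‖ := by
  have hK : ∀ y : T3, Integrable fun x : T3 => boxKernel l x y := fun y =>
    EABirthS0b.integrable_boxKernel_left hl.le y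
  have hpt : ∀ x, ‖empiricalMomentumField w (boxKernel l x)‖ ≤
      ((N : ℝ) + 1)⁻¹ * ∑ i, boxKernel l x (w i).1 * ‖(w i).2‖ := fun x => by
    rw [empiricalMomentumField_eq_sum, norm_smul, Nat.cast_add_one, Real.norm_of_nonneg (by positivity)]
    refine mul_le_mul_of_nonneg_left ((norm_sum_le _ _).trans (le_of_eq (Finset.sum_congr rfl
      fun i _ => ?_))) (by positivity)
    rw [norm_smul, Real.norm_eq_abs,
      abs_of_nonneg (show 0 ≤ boxKernel l x (w i).1 from LGFS.boxK_nonneg hl.le x _)]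
  calc ∫ x, ‖empiricalMomentumField w (boxKernel l x)‖
      ≤ ∫ x, ((N : ℝ) + 1)⁻¹ * ∑ i, boxKernel l x (w i).1 * ‖(w i).2‖ :=
        integral_mono (integrable_fields hl.le w).2.1.norm
          ((integrable_finsetSum _ fun i _ => (hK _).mul_const _).const_mul _) hpt
    _ = ((N : ℝ) + 1)⁻¹ * ∑ i, ‖(w i).2‖ := by
        rw [integral_const_mul, integral_finsetSum _ fun i _ => (hK _).mul_const _]
        refine congrArg _ (Finset.sum_congr rfl fun i _ => ?_)
        rw [integral_mul_const, integral_boxKernel_left hl hl1, one_mul]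

/-- `(N+1)⁻¹ Σ ‖vᵢ‖ ≤ 1/2 + ½ (N+1)⁻¹ Σ ‖vᵢ‖²` (`‖v‖ ≤ (1 + ‖v‖²)/2` termwise). -/
theorem meanNorm_le (w : Config (N + 1) (Fin 3) T3) :
    ((N : ℝ) + 1)⁻¹ * ∑ i, ‖(w i).2‖ ≤ 1 / 2 + 1 / 2 * (((N : ℝ) + 1)⁻¹ * ∑ i, ‖(w i).2‖ ^ 2) := by
  have h1 : ∑ i, ‖(w i).2‖ ≤ ∑ i : Fin (N + 1), (1 / 2 + 1 / 2 * ‖(w i).2‖ ^ 2) :=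
    Finset.sum_le_sum fun i _ => by nlinarith [sq_nonneg (‖(w i).2‖ - 1)]
  rw [Finset.sum_add_distrib, Finset.sum_const, Finset.card_univ, Fintype.card_fin, nsmul_eq_mul,
    ← Finset.mul_sum] at h1
  have hn : (0 : ℝ) < (N : ℝ) + 1 := by positivity
  calc ((N : ℝ) + 1)⁻¹ * ∑ i, ‖(w i).2‖
      ≤ ((N : ℝ) + 1)⁻¹ * (((N + 1 : ℕ) : ℝ) * (1 / 2) + 1 / 2 * ∑ i, ‖(w i).2‖ ^ 2) :=
        mul_le_mul_of_nonneg_left h1 (inv_nonneg.2 hn.le)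
    _ = 1 / 2 + 1 / 2 * (((N : ℝ) + 1)⁻¹ * ∑ i, ‖(w i).2‖ ^ 2) := by
        rw [Nat.cast_add_one, mul_add, ← mul_assoc, inv_mul_cancel₀ hn.ne']; ring

/-- **`N`-uniform bound for linear-growth box functionals**: if `|G(r, m, e)| ≤ |r| + ‖m‖` and `‖ψ‖ ≤ D`,
then `|∫ G(ρ̂, m̂, Ê)(w, x) ψ(x) dx| ≤ D (3/2 + ½ (N+1)⁻¹ Σ‖vᵢ‖²)` for every configuration `w`. -/
theorem abs_integral_growth_le {l : ℝ} (hl : 0 < l) (hl1 : l ≤ 1) {G : ℝ × V3 × ℝ → ℝ}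
    (hG : ∀ p, |G p| ≤ |p.1| + ‖p.2.1‖) {ψ : T3 → ℝ} {D : ℝ} (hD : ∀ x, ‖ψ x‖ ≤ D)
    (w : Config (N + 1) (Fin 3) T3) :
    |∫ x, G (fields l w x) * ψ x| ≤ 3 / 2 * D + D / 2 * (((N : ℝ) + 1)⁻¹ * ∑ i, ‖(w i).2‖ ^ 2) := by
  have hD0 : 0 ≤ D := (norm_nonneg _).trans (hD 0)
  have hi := integrable_fields hl.le w
  have h1 : |∫ x, G (fields l w x) * ψ x| ≤
      ∫ x, D * (empiricalDensityField w (boxKernel l x) + ‖empiricalMomentumField w (boxKernel l x)‖) := by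
    rw [← Real.norm_eq_abs]
    refine norm_integral_le_of_norm_le ((hi.1.add hi.2.1.norm).const_mul D) (Eventually.of_forall fun x => ?_)
    rw [norm_mul, Real.norm_eq_abs, mul_comm]
    refine mul_le_mul (hD x) ((hG _).trans (le_of_eq ?_)) (abs_nonneg _) hD0
    rw [show (fields l w x).1 = empiricalDensityField w (boxKernel l x) from rfl,
      show (fields l w x).2.1 = empiricalMomentumField w (boxKernel l x) from rfl,
      abs_of_nonneg (density_nonneg hl.le w x)]
  rw [integral_const_mul, integral_add hi.1 hi.2.1.norm, integral_density_eq_one hl hl1] at h1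
  have h2 := (integral_norm_momentum_le hl hl1 w).trans (meanNorm_le w)
  nlinarith [h2]

/-- **`N`-uniform Maxwellian bound**: `E_{P_N}[(N+1)⁻¹ Σ ‖vᵢ‖²] ≤ K` for one constant `K = U² + 3Θ` of the
profiles, for all `σ`, `N` and flows (`lintegral_meanVelObs_localGibbsMeasure_le`). -/
theorem exists_lintegral_meanKinetic_le {a₀ θ₀ : T3 → ℝ} {u₀ : T3 → V3} (ha : Continuous a₀)
    (hθ : Continuous θ₀) (hu : Continuous u₀) (ha0 : ∀ x, 0 ≤ a₀ x) (hθ0 : ∀ x, 0 < θ₀ x) :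
    ∃ K : ℝ, 0 ≤ K ∧ ∀ (σ : ℝ) (N : ℕ)
      (Φ : HardSphereFlow (Literature.Analysis.FluidPDE.Torus.geometry (Fin 3)) (hsDiameter σ N) (N + 1)),
      ∫⁻ z, ENNReal.ofReal (((N : ℝ) + 1)⁻¹ * ∑ i, ‖(z i).2‖ ^ 2) ∂(localGibbsLaw σ a₀ u₀ θ₀ N Φ) ≤
        ENNReal.ofReal K := by
  obtain ⟨U, hU0, hU⟩ := exists_forall_abs_le_of_continuous (χ := fun x => ‖u₀ x‖) hu.norm
  obtain ⟨Θ, hΘ0, hΘ⟩ := exists_forall_abs_le_of_continuous hθ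
  refine ⟨U ^ 2 + 3 * Θ, by positivity, fun σ N Φ => ?_⟩
  rw [localGibbsLaw_eq]
  refine lintegral_meanVelObs_localGibbsMeasure_le ha hθ hu ha0 hθ0 (f := fun v : V3 => ‖v‖ ^ 2)
    (by fun_prop) (fun v => sq_nonneg _) (fun y => ?_) σ N
  rw [lintegral_norm_sq_gaussMeasure (u₀ y) (hθ0 y)]
  have h1 : ‖u₀ y‖ ≤ U := by simpa only [abs_of_nonneg (norm_nonneg _)] using hU y
  exact ENNReal.ofReal_le_ofReal (by nlinarith [(le_abs_self _).trans (hΘ y), pow_le_pow_left₀ (norm_nonneg _) h1 2])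

end Statics

/-! ## The registered helper stub -/

/-- Signature of the registered helper stub `stub_entropyBalanceConcentration_of_PTBCA` (file A of S2b): the
unit `x`-mass of the box density, the `x`-integrated momentum bound, and "concentration about the mean costs at
most twice the distance to any constant". -/
def Sig.stub_entropyBalanceConcentration_of_PTBCA : Prop :=
  (∀ (N : ℕ) (l : ℝ), 0 < l → l ≤ 1 → ∀ w : Config (N + 1) (Fin 3) T3,
      ∫ x, empiricalDensityField w (boxKernel l x) = 1) ∧
    (∀ (N : ℕ) (l : ℝ), 0 < l → l ≤ 1 → ∀ w : Config (N + 1) (Fin 3) T3,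
      ∫ x, ‖empiricalMomentumField w (boxKernel l x)‖ ≤ ((N : ℝ) + 1)⁻¹ * ∑ i, ‖(w i).2‖) ∧
    ∀ {Ω : Type} [MeasurableSpace Ω] (μ : Measure Ω) [IsProbabilityMeasure μ] (f : Ω → ℝ),
      Integrable f μ → ∀ c : ℝ,
        ∫⁻ ω, ENNReal.ofReal |f ω - ∫ ω', f ω' ∂μ| ∂μ ≤ 2 * ∫⁻ ω, ENNReal.ofReal |f ω - c| ∂μ

/-- **Registered helper stub `stub_entropyBalanceConcentration_of_PTBCA`** (crux stmt-AtomisticToContinuum-9903,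
line `registered`; toolbox of S2b): packaged statics of the box fields and the `L¹` bookkeeping lemma. -/
theorem stub_entropyBalanceConcentration_of_PTBCA : Sig.stub_entropyBalanceConcentration_of_PTBCA :=
  ⟨fun _ _ hl hl1 w => integral_density_eq_one hl hl1 w,
    fun _ _ hl hl1 w => integral_norm_momentum_le hl hl1 w,
    fun μ _ _ hf c => lintegral_ofReal_abs_sub_integral_le μ hf c⟩

end Summit.AtomisticToContinuum.HydrodynamicLimit.Theorems.EABirthS2bA

end
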